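import Literature.Probability.LatticeModels.DobrushinComparisonMetric
import Literature.Probability.LatticeModels.GibbsSpecificationDLRProofs
import Mathlib.Probability.Kernel.MeasurableIntegral
import Mathlib.Probability.Moments.Covariance
import Mathlib.Topology.MetricSpace.HausdorffDistance
import HarnessLib

/-!
# Dobrushin uniqueness and covariance decay in the Vasserstein form, for a general specification

Second file of the Vasserstein (Kantorovich–Rubinstein) form of Dobrushin's contraction technique
(`DobrushinComparisonMetric.lean` is the abstract dusting part). Here we supply the measure
theory for a **general specification** `γ` on `V → S` in Georgii's sense
(`Literature.Probability.LatticeModels.IsSpecification`):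

* the single-site averaging operators `T_x f (η) = ∫ f dγ_{x}(· | η)` (`siteAvg`) and the
  single-site laws `γ_{x}(σ_x ∈ · | η)` (`siteLaw`); by properness
  `T_x f (η) = ∫ f(η^{x ← s}) γ_{x}(σ_x ∈ ds | η)` (`siteAvg_eq_integral_siteLaw`);
* **Dobrushin's condition in the Vasserstein form** as a hypothesis on `γ`
  (`IsKRContraction γ r nbr C`, Föllmer 1988, Ch. I, (2.20): the one-site law at `x` depends on
  the boundary condition only through the finitely many sites `nbr x`, and changing the spin at
  `y ∈ nbr x` moves it by at most `C x y · r(ω_y, η_y)` in the Kantorovich–Rubinstein distance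
  dual to the weight `r`, tested on bounded measurable `r`-Lipschitz functions);
* the **dusting estimate** `δ_y(T_x f) ≤ δ_y(f) + C x y δ_x(f)`, `δ_x(T_x f) = 0`
  (`isLipBound_siteAvg`, Föllmer 1988, Ch. I, proof of Lemma (2.5)), whence the dusting data
  `krDustingData`;
* invariant states: Gibbs measures (DLR equations) and Gibbs measures tilted by a nonnegative
  local density (properness), `isInvariantState_integral_of_isGibbsMeasure`,
  `isInvariantState_tilt`;
* **uniqueness** (Föllmer 1988, Ch. I, (2.9) with Remark (2.17); Dobrushin 1970): under
  `sup_x ∑_y C x y ≤ c < 1`, two Gibbs measures agree on bounded measurable local observables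
  with finite coordinatewise Lipschitz constants (`integral_eq_of_isGibbsMeasure`); when the
  weight dominates `dist ∘ val` for a measurable map `val` into a pseudo-metric space generating
  the σ-algebra of `S`, such observables determine probability measures
  (`measure_eq_of_forall_integral_eq_of_isLipBound`: closed boxes form a generating π-system and
  their indicators are monotone limits of products of the Lipschitz functions
  `max 0 (1 - n · infDist)`), so `𝒢(γ)` has at most one element
  (`subsingleton_gibbsMeasures_of_isKRContraction`);
* **covariance decay** (Föllmer 1988, Ch. I, Thm. (2.13)/(2.23); Künsch 1982; Georgii 2011,
  §8.2): for the (unique) Gibbs measure and local observables `f, g`,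
  `|cov_μ(f, g)| ≤ 2 R² (∑_y δ_y(g)) ∑_{y ∈ Δ_f} c^{ℓ(y)} δ_y(f)` for every profile `ℓ` vanishing
  on the dependence set of `g` and `1`-Lipschitz along the support of `C`
  (`abs_covariance_le_of_isKRContraction`) — compare `μ` with its tilt by
  `g - g(τ₀) + R ∑ δ(g) ≥ 0`, which is an invariant state off `Δ_g`.

## References

* H. Föllmer, *Random fields and diffusion processes*, Saint-Flour XV–XVII, LNM 1362 (1988),
  Ch. I, §2: Lemma (2.5), (2.8), (2.9), Thm. (2.13), Remark (2.17) with (2.18)–(2.23).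
* R. L. Dobrushin, Theory Probab. Appl. 15 (1970) 458–486, Thm. 3–4.
* H. Künsch, *Decay of correlations under Dobrushin's uniqueness condition and its
  applications*, Comm. Math. Phys. 84 (1982) 207–222.
* H.-O. Georgii, *Gibbs Measures and Phase Transitions*, 2nd ed. (2011), Thm. 8.7, Thm. 8.20,
  Remark 8.26, §8.2.
* S. Friedli, Y. Velenik, *Statistical Mechanics of Lattice Systems* (2017), §6.5.2, Lemma 6.22.
-/

noncomputable section

open MeasureTheory ProbabilityTheory Finset Function Filter
open scoped ENNReal Topology

namespace Literature.Probability.LatticeModels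

namespace DobrushinMetric

variable {V S : Type*} [MeasurableSpace S]

/-! ### Single-site averaging operators and single-site laws of a specification -/

/-- The **single-site averaging operator** of the specification `γ` at `x`:
`T_x f (η) = ∫ f dγ_{x}(· | η)` (Föllmer 1988, Ch. I, (2.4): `π_{{k}} f`; Friedli–Velenik 2017,
Lemma 6.34). [cite: Follmer1988, Ch. I (2.4)] -/
def siteAvg (γ : Specification V S) (x : V) (f : (V → S) → ℝ) (η : V → S) : ℝ :=
  ∫ σ, f σ ∂(γ {x} η)

/-- The **single-site law** of the specification `γ` at `x` with boundary condition `η`: the law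
of `σ_x` under `γ_{x}(· | η)` (Föllmer 1988, Ch. I, §2.1: `π_k(· | η)`, "the conditional
distribution of `ω(k)`"). [cite: Follmer1988, Ch. I (2.1)] -/
def siteLaw (γ : Specification V S) (x : V) (η : V → S) : Measure S :=
  (γ {x} η).map fun σ => σ x

variable {γ : Specification V S}

/-- The single-site law is a probability measure. [cite: Follmer1988, Ch. I (2.1)] -/
theorem isProbabilityMeasure_siteLaw (hγ : IsSpecification γ) (x : V) (η : V → S) :
    IsProbabilityMeasure (siteLaw γ x η) := by
  haveI := hγ.isProbability {x} η
  exact Measure.isProbabilityMeasure_map (measurable_pi_apply x).aemeasurable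

/-- `T_x f` is measurable for measurable `f` (the kernel `γ_{x}` is measurable; Mathlib
`StronglyMeasurable.integral_kernel`). [folklore] -/
theorem measurable_siteAvg (hγ : IsSpecification γ) (x : V) {f : (V → S) → ℝ}
    (hf : Measurable f) : Measurable (siteAvg γ x f) := by
  let κ : Kernel (V → S) (V → S) := ⟨γ {x}, hγ.measurable_fun {x}⟩
  exact (hf.stronglyMeasurable.integral_kernel (κ := κ)).measurable

/-- `|T_x f| ≤ M` if `|f| ≤ M` (the kernels are probability measures). [folklore] -/
theorem abs_siteAvg_le (hγ : IsSpecification γ) (x : V) {f : (V → S) → ℝ} {M : ℝ}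
    (hM : ∀ σ, |f σ| ≤ M) (η : V → S) : |siteAvg γ x f η| ≤ M := by
  haveI := hγ.isProbability {x} η
  have h := norm_integral_le_of_norm_le_const (μ := γ {x} η) (f := f) (C := M)
    (ae_of_all _ fun σ => by rw [Real.norm_eq_abs]; exact hM σ)
  simpa [siteAvg] using h

/-- A bounded measurable observable is integrable for every finite measure. [folklore] -/
theorem integrable_of_abs_le' {μ : Measure (V → S)} [IsFiniteMeasure μ]
    {f : (V → S) → ℝ} (hfm : Measurable f) {M : ℝ} (hM : ∀ σ, |f σ| ≤ M) : Integrable f μ :=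
  Integrable.of_bound hfm.aestronglyMeasurable M (ae_of_all _ fun σ => by
    rw [Real.norm_eq_abs]; exact hM σ)

/-- **Properness, functional form**: `T_x f (η) = ∫ f(η^{x ← s}) γ_{x}(σ_x ∈ ds | η)` — under
`γ_{x}(· | η)` the configuration agrees with `η` off `x`, so only the law of the spin at `x`
matters (Föllmer 1988, Ch. I, §2.1, first display: `π_{{k}}(η, ·) = π_k(· | η) × ∏_{i ≠ k} δ_{η(i)}`).
[cite: Follmer1988, Ch. I (2.1)] -/
theorem siteAvg_eq_integral_siteLaw [DecidableEq V] (hγ : IsSpecification γ) (x : V)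
    {f : (V → S) → ℝ} (hf : Measurable f) (η : V → S) :
    siteAvg γ x f η = ∫ s, f (Function.update η x s) ∂(siteLaw γ x η) := by
  rw [siteLaw, integral_map (measurable_pi_apply x).aemeasurable
    ((hf.comp (measurable_update η)).aestronglyMeasurable)]
  refine integral_congr_ae ?_
  filter_upwards [hγ.proper {x} η] with σ hσ
  congr 1
  funext z
  by_cases hz : z = x
  · subst hz; simp
  · rw [Function.update_of_ne hz]
    exact hσ z (by simpa using hz)

/-! ### Dobrushin's condition in the Vasserstein form -/

/-- **Dobrushin's weak-dependence condition in the Vasserstein (Kantorovich–Rubinstein) form**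
for the one-site kernels of a specification `γ`, relative to a weight `r` on pairs of spins
(Föllmer 1988, Ch. I, (2.20); Dobrushin 1970, §3): (i) `x ∉ nbr x` and the one-site law at `x`
depends on the boundary condition only through the sites of the finite set `nbr x`
(finite range); (ii) for `y ∈ nbr x` and boundary conditions `ω = η` off `y`,
`|∫ φ dγ_x(· | ω) - ∫ φ dγ_x(· | η)| ≤ C x y · L · r(ω_y, η_y)` for every bounded measurable
`φ : S → ℝ` with `|φ a - φ b| ≤ L r(a, b)` — i.e. `R(γ_x(· | ω), γ_x(· | η)) ≤ C x y · r(ω_y, η_y)`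
for the Kantorovich–Rubinstein distance (2.18) dual to `r`, written without introducing that
distance. The row sums `∑_{y ∈ nbr x} C x y` are Dobrushin's constants.
[cite: Follmer1988, Ch. I (2.20)] -/
structure IsKRContraction (γ : Specification V S) (r : S → S → ℝ) (nbr : V → Finset V)
    (C : V → V → ℝ) : Prop where
  /-- a site is not its own neighbour -/
  not_mem : ∀ x, x ∉ nbr x
  /-- the influence coefficients are nonnegative -/
  nonneg : ∀ x y, 0 ≤ C x y
  /-- finite range: the one-site law at `x` sees the boundary condition only on `nbr x` -/
  siteLaw_congr : ∀ (x : V) (η η' : V → S), (∀ z ∈ nbr x, η z = η' z) →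
    siteLaw γ x η = siteLaw γ x η'
  /-- Kantorovich–Rubinstein contraction of the one-site law under a change of the boundary
  condition at one neighbouring site -/
  contract : ∀ (x : V), ∀ y ∈ nbr x, ∀ (ω η : V → S), (∀ z, z ≠ y → ω z = η z) →
    ∀ (φ : S → ℝ) (L : ℝ), Measurable φ → (∃ M, ∀ s, |φ s| ≤ M) → 0 ≤ L →
      (∀ a b, |φ a - φ b| ≤ L * r a b) →
      |∫ s, φ s ∂(siteLaw γ x ω) - ∫ s, φ s ∂(siteLaw γ x η)| ≤ C x y * L * r (ω y) (η y)

variable {r : S → S → ℝ} {nbr : V → Finset V} {C : V → V → ℝ}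

/-- Under finite range, boundary conditions agreeing off `x` have the same one-site law at `x`.
[cite: Follmer1988, Ch. I (2.20)] -/
theorem IsKRContraction.siteLaw_congr_of_eq_off (hC : IsKRContraction γ r nbr C) (x : V)
    {ω η : V → S} (h : ∀ z, z ≠ x → ω z = η z) : siteLaw γ x ω = siteLaw γ x η :=
  hC.siteLaw_congr x ω η fun z hz => h z (fun hzx => hC.not_mem x (hzx ▸ hz))

/-- **The dusting estimate in Lipschitz form** (Föllmer 1988, Ch. I, proof of Lemma (2.5):
`δ_i(∫ f dπ_k(·|·)) ≤ δ_i(f) + C_{ik} δ_k(f)` for `i ≠ k` and `= 0` for `i = k`, with the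
Vasserstein coefficients (2.20)): for `ω = η` off `y ≠ x`,
`T_x f(ω) - T_x f(η) = ∫ [f(ω^{x←s}) - f(η^{x←s})] γ_x(ds|ω) + [∫ ψ dγ_x(·|ω) - ∫ ψ dγ_x(·|η)]`
with `ψ(s) = f(η^{x←s})`, a `δ_x(f)`-Lipschitz function of the spin; the first term is at most
`δ_y(f) r(ω_y, η_y)` and the second at most `C x y δ_x(f) r(ω_y, η_y)` (zero if `y ∉ nbr x`).
[cite: Follmer1988, Ch. I Lemma (2.5)] -/
theorem isLipBound_siteAvg [DecidableEq V] (hγ : IsSpecification γ)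
    (hC : IsKRContraction γ r nbr C) (x : V) {f : (V → S) → ℝ}
    (hfm : Measurable f) {M : ℝ} (hM : ∀ σ, |f σ| ≤ M) {δ : V → ℝ} (hδ : IsLipBound r f δ) :
    IsLipBound r (siteAvg γ x f) fun y =>
      if y = x then 0 else δ y + (if y ∈ nbr x then C x y else 0) * δ x := by
  refine ⟨fun y => ?_, fun y ω η hωη => ?_⟩
  · split_ifs
    · exact le_rfl
    · exact add_nonneg (hδ.nonneg y) (mul_nonneg (hC.nonneg x y) (hδ.nonneg x))
    · simpa using hδ.nonneg y
  haveI := isProbabilityMeasure_siteLaw hγ x ω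
  haveI := isProbabilityMeasure_siteLaw hγ x η
  -- Lipschitz property of `s ↦ f (τ^{x ← s})` in the spin, and in the boundary condition
  have hψx : ∀ (τ : V → S) (a b : S),
      |f (Function.update τ x a) - f (Function.update τ x b)| ≤ δ x * r a b := fun τ a b => by
    have h := hδ.le x (Function.update τ x a) (Function.update τ x b) fun z hz => by
      rw [Function.update_of_ne hz, Function.update_of_ne hz]
    simpa using h
  have hmeas : ∀ τ : V → S, Measurable fun s => f (Function.update τ x s) := fun τ =>
    hfm.comp (measurable_update τ)
  have hint : ∀ (τ : V → S) (m : Measure S) [IsFiniteMeasure m],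
      Integrable (fun s => f (Function.update τ x s)) m := fun τ m _ =>
    Integrable.of_bound (hmeas τ).aestronglyMeasurable M (ae_of_all _ fun s => by
      rw [Real.norm_eq_abs]; exact hM _)
  by_cases hyx : y = x
  · -- `T_x f` does not depend on the spin at `x`
    subst hyx
    rw [if_pos rfl, zero_mul]
    have hupd : ∀ s, Function.update ω y s = Function.update η y s := fun s => by
      funext z
      by_cases hz : z = y
      · subst hz; simp
      · rw [Function.update_of_ne hz, Function.update_of_ne hz]; exact hωη z hz
    rw [siteAvg_eq_integral_siteLaw hγ y hfm, siteAvg_eq_integral_siteLaw hγ y hfm,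
      hC.siteLaw_congr_of_eq_off y hωη]
    simp [hupd]
  rw [if_neg hyx]
  -- first term: transport of the boundary condition inside `f`
  have h1 : |∫ s, f (Function.update ω x s) ∂(siteLaw γ x ω) -
      ∫ s, f (Function.update η x s) ∂(siteLaw γ x ω)| ≤ δ y * r (ω y) (η y) := by
    rw [← integral_sub (hint ω _) (hint η _)]
    have hpt : ∀ s, |f (Function.update ω x s) - f (Function.update η x s)| ≤
        δ y * r (ω y) (η y) := fun s => by
      have h := hδ.le y (Function.update ω x s) (Function.update η x s) fun z hz => by
        by_cases hzx : z = x
        · subst hzx; simp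
        · rw [Function.update_of_ne hzx, Function.update_of_ne hzx]; exact hωη z hz
      rwa [Function.update_of_ne hyx, Function.update_of_ne hyx] at h
    have h := norm_integral_le_of_norm_le_const (μ := siteLaw γ x ω)
      (f := fun s => f (Function.update ω x s) - f (Function.update η x s))
      (C := δ y * r (ω y) (η y)) (ae_of_all _ fun s => by rw [Real.norm_eq_abs]; exact hpt s)
    simpa using h
  -- second term: Kantorovich–Rubinstein contraction of the one-site law
  have h2 : |∫ s, f (Function.update η x s) ∂(siteLaw γ x ω) -
      ∫ s, f (Function.update η x s) ∂(siteLaw γ x η)| ≤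
      (if y ∈ nbr x then C x y else 0) * δ x * r (ω y) (η y) := by
    by_cases hy : y ∈ nbr x
    · rw [if_pos hy]
      exact hC.contract x y hy ω η hωη (fun s => f (Function.update η x s)) (δ x) (hmeas η)
        ⟨M, fun s => hM _⟩ (hδ.nonneg x) (hψx η)
    · rw [if_neg hy, zero_mul, zero_mul]
      have hlaw : siteLaw γ x ω = siteLaw γ x η :=
        hC.siteLaw_congr x ω η fun z hz => hωη z (fun hzy => hy (hzy ▸ hz))
      rw [hlaw, sub_self, abs_zero]
  rw [siteAvg_eq_integral_siteLaw hγ x hfm, siteAvg_eq_integral_siteLaw hγ x hfm]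
  calc |∫ s, f (Function.update ω x s) ∂(siteLaw γ x ω) -
        ∫ s, f (Function.update η x s) ∂(siteLaw γ x η)|
      ≤ |∫ s, f (Function.update ω x s) ∂(siteLaw γ x ω) -
          ∫ s, f (Function.update η x s) ∂(siteLaw γ x ω)| +
        |∫ s, f (Function.update η x s) ∂(siteLaw γ x ω) -
          ∫ s, f (Function.update η x s) ∂(siteLaw γ x η)| := abs_sub_le _ _ _
    _ ≤ δ y * r (ω y) (η y) + (if y ∈ nbr x then C x y else 0) * δ x * r (ω y) (η y) :=
        add_le_add h1 h2
    _ = (δ y + (if y ∈ nbr x then C x y else 0) * δ x) * r (ω y) (η y) := by ring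

/-- **`T_x f` is local**: if `f` depends only on the spins in `Δ`, then `T_x f` depends only on
the spins in `Δ ∪ nbr x` (finite range of the one-site law and properness; Föllmer 1988, Ch. I,
(2.4)). [cite: Follmer1988, Ch. I (2.4)] -/
theorem dependsOn_siteAvg [DecidableEq V] (hγ : IsSpecification γ)
    (hC : IsKRContraction γ r nbr C) (x : V) {f : (V → S) → ℝ} (hfm : Measurable f)
    {Δ : Finset V} (hdep : DependsOn f (↑Δ : Set V)) :
    DependsOn (siteAvg γ x f) (↑(Δ ∪ nbr x) : Set V) := by
  intro η η' h
  have hlaw : siteLaw γ x η = siteLaw γ x η' :=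
    hC.siteLaw_congr x η η' fun z hz => h z (by simp [hz])
  change siteAvg γ x f η = siteAvg γ x f η'
  rw [siteAvg_eq_integral_siteLaw hγ x hfm, siteAvg_eq_integral_siteLaw hγ x hfm, hlaw]
  refine integral_congr_ae (ae_of_all _ fun s => hdep fun z hz => ?_)
  by_cases hzx : z = x
  · subst hzx; simp
  · rw [Function.update_of_ne hzx, Function.update_of_ne hzx]
    exact h z (by simp [Finset.mem_coe.1 hz])

/-! ### The dusting data of a specification satisfying Dobrushin's condition -/

/-- **The dusting data of a specification under Dobrushin's condition in the Vasserstein form**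
(Föllmer 1988, Ch. I, §2.1 with Remark (2.17)): admissible observables are the bounded
measurable local functions, `T_x = γ_x` (`siteAvg`), influence coefficients `C x y 𝟙[y ∈ nbr x]`,
weight `r` bounded by `R`, usable sites `W`; the dusting estimate is `isLipBound_siteAvg`.
[cite: Follmer1988, Ch. I Lemma (2.5)] -/
def krDustingData [DecidableEq V] (hγ : IsSpecification γ) (hC : IsKRContraction γ r nbr C)
    {R : ℝ} (hr0 : ∀ a b, 0 ≤ r a b) (hrR : ∀ a b, r a b ≤ R) (hR : 0 ≤ R) (W : Set V) :
    DustingData V S where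
  r := r
  R := R
  P f Δ := Measurable f ∧ DependsOn f (↑Δ : Set V) ∧ ∃ M, ∀ σ, |f σ| ≤ M
  T x f := siteAvg γ x f
  C x y := if y ∈ nbr x then C x y else 0
  nbr := nbr
  W := W
  r_nonneg := hr0
  r_le := hrR
  R_nonneg := hR
  dependsOn_of h := h.2.1
  exists_of {f Δ} x _ h := ⟨Δ ∪ nbr x, measurable_siteAvg hγ x h.1,
    dependsOn_siteAvg hγ hC x h.1 h.2.1, h.2.2.imp fun M hM σ => abs_siteAvg_le hγ x hM σ⟩
  C_nonneg x y := by
    split_ifs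
    · exact hC.nonneg x y
    · exact le_rfl
  C_eq_zero x y hy := if_neg hy
  dust {f Δ δ} x _ hf hδ := by
    obtain ⟨hfm, -, M, hM⟩ := hf
    exact isLipBound_siteAvg hγ hC x hfm hM hδ

/-- The row sums of the dusting data are Dobrushin's constants `∑_{y ∈ nbr x} C x y`.
[cite: Follmer1988, Ch. I (2.7)] -/
theorem sum_krDustingData_C [DecidableEq V] (hγ : IsSpecification γ)
    (hC : IsKRContraction γ r nbr C) {R : ℝ} (hr0 : ∀ a b, 0 ≤ r a b) (hrR : ∀ a b, r a b ≤ R)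
    (hR : 0 ≤ R) (W : Set V) (x : V) :
    ∑ y ∈ (krDustingData hγ hC hr0 hrR hR W).nbr x, (krDustingData hγ hC hr0 hrR hR W).C x y =
      ∑ y ∈ nbr x, C x y := by
  change ∑ y ∈ nbr x, (if y ∈ nbr x then C x y else 0) = _
  exact Finset.sum_congr rfl fun y hy => if_pos hy

/-! ### Invariant states -/

/-- **A Gibbs measure is an invariant state** for the dusting data (any `W`): its expectation is
monotone-normalised and `μ(γ_x f) = μ(f)` by the DLR equations (Föllmer 1988, Ch. I, proof of
Lemma (2.5), first display; Georgii 2011, Thm. 8.7). [cite: Follmer1988, Ch. I Lemma (2.5)] -/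
theorem isInvariantState_integral_of_isGibbsMeasure [DecidableEq V] (hγ : IsSpecification γ)
    (hC : IsKRContraction γ r nbr C) {R : ℝ} (hr0 : ∀ a b, 0 ≤ r a b) (hrR : ∀ a b, r a b ≤ R)
    (hR : 0 ≤ R) (W : Set V) {μ : Measure (V → S)} (hμ : IsGibbsMeasure γ μ) :
    (krDustingData hγ hC hr0 hrR hR W).IsInvariantState fun f => ∫ σ, f σ ∂μ := by
  haveI := hμ.isProbabilityMeasure
  refine ⟨fun {f Δ M} hf hM => ?_, fun {f Δ m} hf hm => ?_, fun {f Δ} x _ hf => ?_⟩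
  · obtain ⟨hfm, -, B, hB⟩ := hf
    calc ∫ σ, f σ ∂μ ≤ ∫ _σ, M ∂μ := integral_mono (integrable_of_abs_le' hfm hB)
          (integrable_const M) hM
      _ = M := by simp
  · obtain ⟨hfm, -, B, hB⟩ := hf
    calc m = ∫ _σ, m ∂μ := by simp
      _ ≤ ∫ σ, f σ ∂μ := integral_mono (integrable_const m) (integrable_of_abs_le' hfm hB) hm
  · obtain ⟨hfm, -, B, hB⟩ := hf
    exact hμ.integral_integral_eq hγ {x} (integrable_of_abs_le' hfm hB)

/-- **Tilting a Gibbs measure by a nonnegative local density gives an invariant state off the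
support of the density**: for `g ≥ 0` bounded measurable depending only on the spins in `Δ_g`,
`μ(g) > 0` and `x ∉ Δ_g`, `μ(g · γ_x f) = μ(γ_x (g f)) = μ(g f)` by properness and the DLR
equations (the device behind the covariance estimates in Dobrushin's regime: Föllmer 1988,
Ch. I, proof of Thm. (2.13), `dν = g dμ`; Georgii 2011, §8.2; Künsch 1982).
[cite: Follmer1988, Ch. I Theorem (2.13)] -/
theorem isInvariantState_tilt [DecidableEq V] (hγ : IsSpecification γ)
    (hC : IsKRContraction γ r nbr C) {R : ℝ} (hr0 : ∀ a b, 0 ≤ r a b) (hrR : ∀ a b, r a b ≤ R)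
    (hR : 0 ≤ R) {μ : Measure (V → S)} (hμ : IsGibbsMeasure γ μ) {g : (V → S) → ℝ}
    (hgm : Measurable g) {Δg : Finset V} (hgdep : DependsOn g (↑Δg : Set V))
    (hg0 : ∀ σ, 0 ≤ g σ) {B : ℝ} (hgB : ∀ σ, g σ ≤ B) (hgpos : 0 < ∫ σ, g σ ∂μ) :
    (krDustingData hγ hC hr0 hrR hR ((↑Δg : Set V)ᶜ)).IsInvariantState
      fun f => (∫ σ, g σ * f σ ∂μ) / ∫ σ, g σ ∂μ := by
  haveI := hμ.isProbabilityMeasure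
  have hgabs : ∀ σ, |g σ| ≤ B := fun σ => by rw [abs_of_nonneg (hg0 σ)]; exact hgB σ
  have hgi : Integrable g μ := integrable_of_abs_le' hgm hgabs
  have hgfi : ∀ {f : (V → S) → ℝ}, Measurable f → ∀ {M : ℝ}, (∀ σ, |f σ| ≤ M) →
      Integrable (fun σ => g σ * f σ) μ := fun hfm M hM =>
    hgi.mul_bdd hfm.aestronglyMeasurable (ae_of_all _ fun σ => by
      rw [Real.norm_eq_abs]; exact hM σ)
  refine ⟨fun {f Δ M} hf hM => ?_, fun {f Δ m} hf hm => ?_, fun {f Δ} x hx hf => ?_⟩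
  · obtain ⟨hfm, -, B', hB'⟩ := hf
    rw [div_le_iff₀ hgpos]
    calc ∫ σ, g σ * f σ ∂μ ≤ ∫ σ, g σ * M ∂μ :=
          integral_mono (hgfi hfm hB') (hgi.mul_const M)
            fun σ => mul_le_mul_of_nonneg_left (hM σ) (hg0 σ)
      _ = M * ∫ σ, g σ ∂μ := by rw [integral_mul_const, mul_comm]
  · obtain ⟨hfm, -, B', hB'⟩ := hf
    rw [le_div_iff₀ hgpos]
    calc m * ∫ σ, g σ ∂μ = ∫ σ, g σ * m ∂μ := by rw [integral_mul_const, mul_comm]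
      _ ≤ ∫ σ, g σ * f σ ∂μ :=
          integral_mono (hgi.mul_const m) (hgfi hfm hB')
            fun σ => mul_le_mul_of_nonneg_left (hm σ) (hg0 σ)
  · obtain ⟨hfm, -, B', hB'⟩ := hf
    have hxΔ : x ∉ Δg := fun h => hx (Finset.mem_coe.2 h)
    -- `g` is blind to the spin at `x`, so it commutes with `γ_x` (properness)
    have hpt : ∀ η, g η * siteAvg γ x f η = ∫ σ, g σ * f σ ∂(γ {x} η) := fun η => by
      rw [siteAvg, ← integral_const_mul]
      refine integral_congr_ae ?_
      filter_upwards [hγ.proper {x} η] with σ hσ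
      rw [hgdep fun i hi => (hσ i fun hix => hxΔ ?_).symm]
      rwa [Finset.mem_singleton.1 hix] at hi
    change (∫ σ, g σ * siteAvg γ x f σ ∂μ) / ∫ σ, g σ ∂μ = (∫ σ, g σ * f σ ∂μ) / ∫ σ, g σ ∂μ
    congr 1
    simp_rw [hpt]
    exact hμ.integral_integral_eq hγ {x} (hgfi hfm hB')

/-! ### Uniqueness -/

/-- **Two Gibbs measures agree on local Lipschitz observables in Dobrushin's regime**
(Föllmer 1988, Ch. I, Uniqueness theorem (2.9) in the Vasserstein form of Remark (2.17);
Dobrushin 1970, Thm. 4; Georgii 2011, Thm. 8.7): if the one-site kernels of `γ` satisfy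
Dobrushin's condition in the Vasserstein form for a bounded weight `0 ≤ r ≤ R` with constants
`∑_{y ∈ nbr x} C x y ≤ c < 1`, then for any two Gibbs measures and every bounded measurable
local observable `f` with finite coordinatewise `r`-Lipschitz constants, `μ(f) = ν(f)`.
[cite: Follmer1988, Ch. I Uniqueness theorem (2.9)] -/
theorem integral_eq_of_isGibbsMeasure (hγ : IsSpecification γ) (hC : IsKRContraction γ r nbr C)
    {R : ℝ} (hr0 : ∀ a b, 0 ≤ r a b) (hrR : ∀ a b, r a b ≤ R) (hR : 0 ≤ R) {c : ℝ} (hc0 : 0 ≤ c)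
    (hc1 : c < 1) (hrow : ∀ x, ∑ y ∈ nbr x, C x y ≤ c) {μ ν : Measure (V → S)}
    (hμ : IsGibbsMeasure γ μ) (hν : IsGibbsMeasure γ ν) {f : (V → S) → ℝ} (hfm : Measurable f)
    {Δ : Finset V} (hdep : DependsOn f (↑Δ : Set V)) {M : ℝ} (hM : ∀ σ, |f σ| ≤ M) {δ : V → ℝ}
    (hδ : IsLipBound r f δ) :
    ∫ σ, f σ ∂μ = ∫ σ, f σ ∂ν := by
  classical
  exact (krDustingData hγ hC hr0 hrR hR Set.univ).eq_of_lt_one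
    (isInvariantState_integral_of_isGibbsMeasure hγ hC hr0 hrR hR Set.univ hμ)
    (isInvariantState_integral_of_isGibbsMeasure hγ hC hr0 hrR hR Set.univ hν) hc0 hc1
    (fun _ => Set.mem_univ _)
    (fun x => (sum_krDustingData_C hγ hC hr0 hrR hR Set.univ x).le.trans (hrow x))
    (f := f) (Δ := Δ) ⟨hfm, hdep, M, hM⟩ hδ

/-! ### Local Lipschitz observables determine the measure -/

section Determine

variable {M : Type*} [PseudoMetricSpace M] [MeasurableSpace M] [BorelSpace M]

variable (V) in
/-- The **closed boxes** of the configuration space relative to a map `val : S → M` into a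
pseudo-metric space: `{σ | ∀ x ∈ Δ, val (σ x) ∈ F x}` with `Δ` finite and all `F x` closed
(Friedli–Velenik 2017, §6.2, cylinders `Π_Λ^{-1}(·)`; here with closed bases, a generating
π-system when the σ-algebra of `S` is induced by `val`). [cite: FriedliVelenik2017, Lemma 6.22] -/
def closedBoxes (val : S → M) : Set (Set (V → S)) :=
  {A | ∃ (Δ : Finset V) (F : V → Set M), (∀ x, IsClosed (F x)) ∧
    A = {σ | ∀ x ∈ Δ, val (σ x) ∈ F x}}

omit [MeasurableSpace S] [MeasurableSpace M] [BorelSpace M] in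
/-- Closed boxes form a π-system. [folklore] -/
theorem isPiSystem_closedBoxes (val : S → M) : IsPiSystem (closedBoxes V val) := by
  classical
  rintro A ⟨Δ₁, F₁, hF₁, rfl⟩ B ⟨Δ₂, F₂, hF₂, rfl⟩ -
  refine ⟨Δ₁ ∪ Δ₂, fun x => (if x ∈ Δ₁ then F₁ x else Set.univ) ∩ (if x ∈ Δ₂ then F₂ x else Set.univ),
    fun x => ?_, ?_⟩
  · refine IsClosed.inter ?_ ?_ <;> split_ifs
    exacts [hF₁ x, isClosed_univ, hF₂ x, isClosed_univ]
  · ext σ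
    simp only [Set.mem_inter_iff, Set.mem_setOf_eq, Finset.mem_union]
    constructor
    · rintro ⟨h₁, h₂⟩ x hx
      refine ⟨?_, ?_⟩
      · split_ifs with h
        · exact h₁ x h
        · exact Set.mem_univ _
      · split_ifs with h
        · exact h₂ x h
        · exact Set.mem_univ _
    · intro h
      refine ⟨fun x hx => ?_, fun x hx => ?_⟩
      · have := (h x (Or.inl hx)).1
        rwa [if_pos hx] at this
      · have := (h x (Or.inr hx)).2
        rwa [if_pos hx] at this

omit [BorelSpace M] in
/-- Closed boxes are measurable for the product σ-algebra when `val` is measurable and closed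
sets of `M` are measurable. [folklore] -/
theorem measurableSet_of_mem_closedBoxes [OpensMeasurableSpace M] {val : S → M}
    (hval : Measurable val) {A : Set (V → S)} (hA : A ∈ closedBoxes V val) : MeasurableSet A := by
  obtain ⟨Δ, F, hF, rfl⟩ := hA
  have : {σ : V → S | ∀ x ∈ Δ, val (σ x) ∈ F x} = ⋂ x ∈ Δ, (fun σ : V → S => val (σ x)) ⁻¹' F x := by
    ext σ; simp
  rw [this]
  exact Finset.measurableSet_biInter Δ fun x _ =>
    (hval.comp (measurable_pi_apply x)) (hF x).measurableSet

/-- **Closed boxes generate the product σ-algebra** when the σ-algebra of the spin space is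
induced by `val` from the Borel σ-algebra of `M` (e.g. `S` a subspace of `M` with the Borel
σ-algebra, `val` the inclusion): `𝓕 = σ(closed boxes)` (Friedli–Velenik 2017, §6.2: the
cylinders generate `𝓕`; the Borel σ-algebra of `M` is generated by the closed sets).
[cite: FriedliVelenik2017, Lemma 6.22] -/
theorem generateFrom_closedBoxes {val : S → M}
    (hS : ‹MeasurableSpace S› = MeasurableSpace.comap val ‹MeasurableSpace M›) :
    (MeasurableSpace.pi : MeasurableSpace (V → S)) =
      MeasurableSpace.generateFrom (closedBoxes V val) := by
  have hval : Measurable val := measurable_iff_comap_le.2 hS.ge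
  refine le_antisymm ?_ (MeasurableSpace.generateFrom_le fun A hA =>
    measurableSet_of_mem_closedBoxes hval hA)
  refine iSup_le fun x => ?_
  rw [hS, MeasurableSpace.comap_comp, ‹BorelSpace M›.measurable_eq, borel_eq_generateFrom_isClosed,
    MeasurableSpace.comap_generateFrom]
  refine MeasurableSpace.generateFrom_le ?_
  rintro _ ⟨F, hF, rfl⟩
  refine MeasurableSpace.measurableSet_generateFrom ⟨{x}, fun _ => F, fun _ => hF, ?_⟩
  ext σ
  simp

omit [MeasurableSpace S] [MeasurableSpace M] [BorelSpace M] in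
/-- The Lipschitz approximants of the indicator of a closed set: `φ_n(m) = max 0 (1 - n d(m, F))`
is `n`-Lipschitz, `[0, 1]`-valued, equal to `1` on `F` and eventually `0` at each point off the
closed set `F` (the standard device by which bounded Lipschitz functions determine a Borel
measure on a metric space). [folklore] -/
theorem abs_lipApprox_sub_le (F : Set M) (n : ℕ) (a b : M) :
    |max (1 - n * Metric.infDist a F) 0 - max (1 - n * Metric.infDist b F) 0| ≤ n * dist a b := by
  refine (abs_max_sub_max_le_abs _ _ _).trans ?_
  have h : |Metric.infDist a F - Metric.infDist b F| ≤ dist a b := by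
    rw [← Real.dist_eq]
    have h1 := (Metric.lipschitz_infDist_pt F).dist_le_mul a b
    simpa using h1
  calc |1 - ↑n * Metric.infDist a F - (1 - ↑n * Metric.infDist b F)|
      = ↑n * |Metric.infDist a F - Metric.infDist b F| := by
        rw [show (1 : ℝ) - n * Metric.infDist a F - (1 - n * Metric.infDist b F) =
          -(n * (Metric.infDist a F - Metric.infDist b F)) by ring, abs_neg, abs_mul,
          Nat.abs_cast]
    _ ≤ ↑n * dist a b := mul_le_mul_of_nonneg_left h (Nat.cast_nonneg n)

omit [MeasurableSpace S] [MeasurableSpace M] [BorelSpace M] in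
/-- The approximants take values in `[0, 1]`. [folklore] -/
theorem lipApprox_mem_Icc (F : Set M) (n : ℕ) (a : M) :
    max (1 - n * Metric.infDist a F) 0 ∈ Set.Icc (0 : ℝ) 1 :=
  ⟨le_max_right _ _, max_le (by nlinarith [Metric.infDist_nonneg (x := a) (s := F), Nat.cast_nonneg (α := ℝ) n]) zero_le_one⟩

omit [MeasurableSpace S] [MeasurableSpace M] [BorelSpace M] in
/-- The approximants converge to the indicator of the closed nonempty set `F`. [folklore] -/
theorem tendsto_lipApprox {F : Set M} (hF : IsClosed F) (hne : F.Nonempty) (a : M) :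
    Tendsto (fun n : ℕ => max (1 - n * Metric.infDist a F) 0) atTop
      (𝓝 (F.indicator 1 a)) := by
  by_cases ha : a ∈ F
  · rw [Set.indicator_of_mem ha, Pi.one_apply, Metric.infDist_zero_of_mem ha]
    simp
  · rw [Set.indicator_of_notMem ha]
    have hpos : 0 < Metric.infDist a F := (hF.notMem_iff_infDist_pos hne).1 ha
    obtain ⟨N, hN⟩ := exists_nat_gt (1 / Metric.infDist a F)
    refine tendsto_atTop_of_eventually_const (i₀ := N) fun n hn => ?_
    refine max_eq_right ?_
    have hn' : (1 : ℝ) / Metric.infDist a F < n := hN.trans_le (by exact_mod_cast hn)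
    rw [div_lt_iff₀ hpos] at hn'
    linarith

/-- **Bounded local Lipschitz observables determine probability measures** (the measure-theoretic
closing step of Dobrushin's uniqueness theorem in the Vasserstein form; Friedli–Velenik 2017,
Lemma 6.22 / proof of Thm. 6.31, "since this holds for all local functions, `μ = ν`", here for
the smaller class `L(Ω)` of Föllmer 1988, Ch. I, Remark (2.17)): if the σ-algebra of `S` is
induced by `val : S → M`, two probability measures on `V → S` that agree on every measurable
`[-1, 1]`-valued observable depending on finitely many coordinates and with finite coordinatewise
`dist ∘ val`-Lipschitz constants are equal. Proof: closed boxes form a generating π-system, and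
the indicator of a closed box is the dominated limit of the products
`∏_{x ∈ Δ} max 0 (1 - n d(val σ_x, F_x))`. [cite: Follmer1988, Ch. I Remark (2.17)] -/
theorem measure_eq_of_forall_integral_eq_of_isLipBound [DecidableEq V] (val : S → M)
    (hS : ‹MeasurableSpace S› = MeasurableSpace.comap val ‹MeasurableSpace M›)
    {μ ν : Measure (V → S)} [IsProbabilityMeasure μ] [IsProbabilityMeasure ν]
    (h : ∀ (f : (V → S) → ℝ) (Δ : Finset V) (δ : V → ℝ), Measurable f →
      DependsOn f (↑Δ : Set V) → (∀ σ, |f σ| ≤ 1) →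
      IsLipBound (fun a b => dist (val a) (val b)) f δ → ∫ σ, f σ ∂μ = ∫ σ, f σ ∂ν) :
    μ = ν := by
  have hval : Measurable val := measurable_iff_comap_le.2 hS.ge
  refine ext_of_generate_finite (closedBoxes V val) (generateFrom_closedBoxes hS)
    (isPiSystem_closedBoxes val) (fun A hA => ?_) (by simp)
  have hAm : MeasurableSet A := measurableSet_of_mem_closedBoxes hval hA
  obtain ⟨Δ, F, hF, rfl⟩ := hA
  by_cases hne : ∀ x ∈ Δ, (F x).Nonempty
  swap
  · push Not at hne
    obtain ⟨x, hx, hFx⟩ := hne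
    have hempty : {σ : V → S | ∀ x ∈ Δ, val (σ x) ∈ F x} = ∅ :=
      Set.eq_empty_of_forall_notMem fun σ hσ => by
        have := hσ x hx
        rw [hFx] at this
        exact this
    rw [hempty]
    simp
  -- the approximants
  set Φ : ℕ → (V → S) → ℝ := fun n σ => ∏ x ∈ Δ, max (1 - n * Metric.infDist (val (σ x)) (F x)) 0
    with hΦ
  have hΦm : ∀ n, Measurable (Φ n) := fun n =>
    Finset.measurable_prod Δ fun x _ => by
      refine Measurable.max ?_ measurable_const
      exact measurable_const.sub (measurable_const.mul
        ((Metric.continuous_infDist_pt (F x)).measurable.comp (hval.comp (measurable_pi_apply x))))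
  have hΦdep : ∀ n, DependsOn (Φ n) (↑Δ : Set V) := fun n σ τ hστ =>
    Finset.prod_congr rfl fun x hx => by rw [hστ x (Finset.mem_coe.2 hx)]
  have hΦ01 : ∀ n σ, Φ n σ ∈ Set.Icc (0 : ℝ) 1 := fun n σ =>
    ⟨Finset.prod_nonneg fun x _ => (lipApprox_mem_Icc (F x) n _).1,
      Finset.prod_le_one (fun x _ => (lipApprox_mem_Icc (F x) n _).1)
        fun x _ => (lipApprox_mem_Icc (F x) n _).2⟩
  have hΦabs : ∀ n σ, |Φ n σ| ≤ 1 := fun n σ => by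
    rw [abs_of_nonneg (hΦ01 n σ).1]; exact (hΦ01 n σ).2
  have hΦlip : ∀ n, IsLipBound (fun a b => dist (val a) (val b)) (Φ n)
      fun y => if y ∈ Δ then (n : ℝ) else 0 := fun n => by
    refine ⟨fun y => by split_ifs <;> positivity, fun y σ τ hστ => ?_⟩
    split_ifs with hy
    · have hrest : ∏ x ∈ Δ.erase y, max (1 - n * Metric.infDist (val (σ x)) (F x)) 0 =
          ∏ x ∈ Δ.erase y, max (1 - n * Metric.infDist (val (τ x)) (F x)) 0 :=
        Finset.prod_congr rfl fun x hx => by rw [hστ x (Finset.ne_of_mem_erase hx)]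
      have hP01 : (∏ x ∈ Δ.erase y, max (1 - n * Metric.infDist (val (τ x)) (F x)) 0) ∈
          Set.Icc (0 : ℝ) 1 :=
        ⟨Finset.prod_nonneg fun x _ => (lipApprox_mem_Icc (F x) n _).1,
          Finset.prod_le_one (fun x _ => (lipApprox_mem_Icc (F x) n _).1)
            fun x _ => (lipApprox_mem_Icc (F x) n _).2⟩
      change |Φ n σ - Φ n τ| ≤ _
      rw [hΦ]
      dsimp only
      rw [← Finset.mul_prod_erase Δ _ hy, ← Finset.mul_prod_erase Δ _ hy, hrest, ← sub_mul,
        abs_mul, abs_of_nonneg hP01.1]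
      calc |max (1 - ↑n * Metric.infDist (val (σ y)) (F y)) 0 -
            max (1 - ↑n * Metric.infDist (val (τ y)) (F y)) 0| *
            ∏ x ∈ Δ.erase y, max (1 - ↑n * Metric.infDist (val (τ x)) (F x)) 0
          ≤ ↑n * dist (val (σ y)) (val (τ y)) * 1 :=
            mul_le_mul (abs_lipApprox_sub_le (F y) n _ _) hP01.2 hP01.1 (by positivity)
        _ = ↑n * dist (val (σ y)) (val (τ y)) := mul_one _
    · rw [hΦdep n (fun x hx => hστ x (fun h' => hy (h' ▸ Finset.mem_coe.1 hx))), sub_self,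
        abs_zero, zero_mul]
  -- pointwise convergence to the indicator of the box
  have hlim : ∀ σ : V → S, Tendsto (fun n => Φ n σ) atTop
      (𝓝 (({σ : V → S | ∀ x ∈ Δ, val (σ x) ∈ F x}).indicator 1 σ)) := by
    intro σ
    have hprod := tendsto_finsetProd Δ (fun x (hx : x ∈ Δ) =>
      tendsto_lipApprox (hF x) (hne x hx) (val (σ x)))
    have hval' : ∏ c ∈ Δ, (F c).indicator (1 : M → ℝ) (val (σ c)) =
        ({σ : V → S | ∀ x ∈ Δ, val (σ x) ∈ F x}).indicator 1 σ := by
      by_cases hσ : σ ∈ {σ : V → S | ∀ x ∈ Δ, val (σ x) ∈ F x}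
      · rw [Set.indicator_of_mem hσ, Pi.one_apply]
        exact Finset.prod_eq_one fun x hx => by
          rw [Set.indicator_of_mem (hσ x hx), Pi.one_apply]
      · rw [Set.indicator_of_notMem hσ]
        simp only [Set.mem_setOf_eq, not_forall] at hσ
        obtain ⟨x, hx, hxF⟩ := hσ
        exact Finset.prod_eq_zero hx (Set.indicator_of_notMem hxF _)
    rw [← hval']
    exact hprod
  -- dominated convergence for both measures
  have hint : ∀ (ρ : Measure (V → S)) [IsProbabilityMeasure ρ],
      Tendsto (fun n => ∫ σ, Φ n σ ∂ρ) atTop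
        (𝓝 (ρ.real {σ : V → S | ∀ x ∈ Δ, val (σ x) ∈ F x})) := by
    intro ρ _
    rw [← integral_indicator_one hAm]
    refine tendsto_integral_of_dominated_convergence (fun _ => (1 : ℝ)) (fun n =>
      (hΦm n).aestronglyMeasurable) (integrable_const 1)
      (fun n => ae_of_all _ fun σ => by rw [Real.norm_eq_abs]; exact hΦabs n σ)
      (ae_of_all _ hlim)
  have heq : ∀ n, ∫ σ, Φ n σ ∂μ = ∫ σ, Φ n σ ∂ν := fun n =>
    h (Φ n) Δ _ (hΦm n) (hΦdep n) (hΦabs n) (hΦlip n)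
  have hreal : μ.real {σ : V → S | ∀ x ∈ Δ, val (σ x) ∈ F x} =
      ν.real {σ : V → S | ∀ x ∈ Δ, val (σ x) ∈ F x} :=
    tendsto_nhds_unique (hint μ) (by simpa only [heq] using hint ν)
  exact (measureReal_eq_measureReal_iff (measure_ne_top μ _) (measure_ne_top ν _)).1 hreal

/-- **Dobrushin's uniqueness theorem in the Vasserstein form** (Föllmer 1988, Ch. I,
Uniqueness theorem (2.9) with Remark (2.17); Dobrushin 1970, Thm. 4; Georgii 2011, Thm. 8.7):
if the one-site kernels of the specification `γ` satisfy Dobrushin's condition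
`IsKRContraction` for a bounded weight `0 ≤ r ≤ R` with constants `∑_{y ∈ nbr x} C x y ≤ c < 1`,
and `r` dominates (up to a constant `A`) the pseudo-metric `dist ∘ val` induced by a map `val`
generating the σ-algebra of the spin space (so that `r`-Lipschitz local observables include the
`dist ∘ val`-Lipschitz ones, which determine the measure), then `γ` admits at most one Gibbs
measure. Typical use: `S` a compact subspace of a normed space `M`, `val` the inclusion, `r` any
metric on `S` equivalent to, or stronger than, the induced one (e.g. a Riemannian distance).
[cite: Follmer1988, Ch. I Uniqueness theorem (2.9)] -/
theorem subsingleton_gibbsMeasures_of_isKRContraction [Nonempty S] (hγ : IsSpecification γ)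
    (hC : IsKRContraction γ r nbr C) {R : ℝ} (hr0 : ∀ a b, 0 ≤ r a b) (hrR : ∀ a b, r a b ≤ R)
    (val : S → M) (hS : ‹MeasurableSpace S› = MeasurableSpace.comap val ‹MeasurableSpace M›)
    {A : ℝ} (hA0 : 0 ≤ A) (hA : ∀ a b, dist (val a) (val b) ≤ A * r a b) {c : ℝ} (hc0 : 0 ≤ c)
    (hc1 : c < 1) (hrow : ∀ x, ∑ y ∈ nbr x, C x y ≤ c) :
    (gibbsMeasures γ).Subsingleton := by
  classical
  intro μ hμ ν hν
  haveI := IsGibbsMeasure.isProbabilityMeasure hμ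
  haveI := IsGibbsMeasure.isProbabilityMeasure hν
  have hR : 0 ≤ R := by
    obtain ⟨a⟩ := ‹Nonempty S›
    exact (hr0 a a).trans (hrR a a)
  refine measure_eq_of_forall_integral_eq_of_isLipBound val hS fun f Δ δ hfm hdep hf1 hδ => ?_
  -- an `A δ`-Lipschitz bound for the weight `r`
  have hδ' : IsLipBound r f fun y => A * δ y :=
    ⟨fun y => mul_nonneg hA0 (hδ.nonneg y), fun y σ τ hστ =>
      (hδ.le y σ τ hστ).trans (by
        calc δ y * dist (val (σ y)) (val (τ y)) ≤ δ y * (A * r (σ y) (τ y)) :=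
              mul_le_mul_of_nonneg_left (hA _ _) (hδ.nonneg y)
          _ = A * δ y * r (σ y) (τ y) := by ring)⟩
  exact integral_eq_of_isGibbsMeasure hγ hC hr0 hrR hR hc0 hc1 hrow hμ hν hfm hdep hf1 hδ'

end Determine

/-! ### Covariance decay -/

/-- **Covariance estimate in Dobrushin's regime, Vasserstein form** (Föllmer 1988, Ch. I,
Thm. (2.13) and (2.23): `|cov_μ(f, g)| ≤ σ² ∑ δ_i(f) D_{ki} δ_k(g)`; Künsch 1982; Georgii 2011,
§8.2): let `γ` satisfy Dobrushin's condition in the Vasserstein form for a weight `0 ≤ r ≤ R`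
with constants `∑_y C x y ≤ c ≤ 1`, let `μ` be a Gibbs measure, `f, g` bounded measurable local
observables with Lipschitz bounds `δ_f, δ_g` and dependence sets `Δ_f, Δ_g`, and let `ℓ : V → ℕ`
vanish on `Δ_g` with `ℓ x ≤ ℓ y + 1` for `y ∈ nbr x`, `x ∉ Δ_g` (e.g. the integer part of the
distance to `Δ_g` when `nbr` has range `1`). Then
`|cov_μ(f, g)| ≤ 2 R² (∑_{y ∈ Δ_g} δ_g y) ∑_{y ∈ Δ_f} c^{ℓ y} δ_f y`.
Proof: `cov(f, g) = μ(g̃) (μ_{g̃}(f) - μ(f))` for the tilt `μ_{g̃} = g̃ μ / μ(g̃)` by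
`g̃ = g - g(τ₀) + R ∑ δ_g ∈ [0, 2R ∑ δ_g]`, an invariant state off `Δ_g`
(`isInvariantState_tilt`), and the profile form of the comparison estimate
(`DustingData.abs_sub_le_sum_pow_profile`) bounds `|μ_{g̃}(f) - μ(f)|` by `R ∑ c^ℓ δ_f`.
[cite: Follmer1988, Ch. I Theorem (2.13)] -/
theorem abs_covariance_le_of_isKRContraction [DecidableEq V] (hγ : IsSpecification γ)
    (hC : IsKRContraction γ r nbr C) {R : ℝ} (hr0 : ∀ a b, 0 ≤ r a b) (hrR : ∀ a b, r a b ≤ R)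
    (hR : 0 ≤ R) {c : ℝ} (hc0 : 0 ≤ c) (hc1 : c ≤ 1) (hrow : ∀ x, ∑ y ∈ nbr x, C x y ≤ c)
    {μ : Measure (V → S)} (hμ : IsGibbsMeasure γ μ) {f g : (V → S) → ℝ} (hfm : Measurable f)
    {Δf : Finset V} (hfdep : DependsOn f (↑Δf : Set V)) {Mf : ℝ} (hMf : ∀ σ, |f σ| ≤ Mf)
    {δf : V → ℝ} (hδf : IsLipBound r f δf) (hgm : Measurable g) {Δg : Finset V}
    (hgdep : DependsOn g (↑Δg : Set V)) {Mg : ℝ} (hMg : ∀ σ, |g σ| ≤ Mg) {δg : V → ℝ}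
    (hδg : IsLipBound r g δg) (ℓ : V → ℕ) (hℓ0 : ∀ y ∈ Δg, ℓ y = 0)
    (hℓ : ∀ x ∉ Δg, ∀ y ∈ nbr x, ℓ x ≤ ℓ y + 1) :
    |cov[f, g; μ]| ≤ 2 * R ^ 2 * (∑ y ∈ Δg, δg y) * ∑ y ∈ Δf, c ^ ℓ y * δf y := by
  haveI := hμ.isProbabilityMeasure
  obtain ⟨τ₀, -⟩ := nonempty_of_measure_ne_zero (μ := μ) (s := Set.univ) (by simp)
  -- the shifted density `g̃ ∈ [0, 2 S_g]`
  set Sg : ℝ := R * ∑ y ∈ Δg, δg y with hSg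
  have hSg0 : 0 ≤ Sg := mul_nonneg hR (Finset.sum_nonneg fun y _ => hδg.nonneg y)
  set gt : (V → S) → ℝ := fun σ => g σ + (Sg - g τ₀) with hgt
  have hosc : ∀ σ, |g σ - g τ₀| ≤ Sg := fun σ =>
    abs_sub_le_mul_sum_of_dependsOn hrR hgdep hδg σ τ₀
  have hgt0 : ∀ σ, 0 ≤ gt σ := fun σ => by
    have := (abs_le.1 (hosc σ)).1; simp only [hgt]; linarith
  have hgtB : ∀ σ, gt σ ≤ 2 * Sg := fun σ => by
    have := (abs_le.1 (hosc σ)).2; simp only [hgt]; linarith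
  have hgtm : Measurable gt := hgm.add_const _
  have hgtdep : DependsOn gt (↑Δg : Set V) := fun σ τ h => by
    simp only [hgt]; rw [hgdep h]
  have hgi : Integrable g μ := integrable_of_abs_le' hgm hMg
  have hfi : Integrable f μ := integrable_of_abs_le' hfm hMf
  have hgtabs : ∀ σ, |gt σ| ≤ 2 * Sg := fun σ => by
    rw [abs_of_nonneg (hgt0 σ)]; exact hgtB σ
  have hgti : Integrable gt μ := integrable_of_abs_le' hgtm hgtabs
  -- the right-hand side is nonnegative
  have hRHS : 0 ≤ 2 * R ^ 2 * (∑ y ∈ Δg, δg y) * ∑ y ∈ Δf, c ^ ℓ y * δf y := by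
    have h1 : 0 ≤ ∑ y ∈ Δg, δg y := Finset.sum_nonneg fun y _ => hδg.nonneg y
    have h2 : 0 ≤ ∑ y ∈ Δf, c ^ ℓ y * δf y :=
      Finset.sum_nonneg fun y _ => mul_nonneg (pow_nonneg hc0 _) (hδf.nonneg y)
    positivity
  -- `cov(f, g) = cov(f, g̃) = μ(f g̃) - μ(f) μ(g̃)`
  have hcov : cov[f, g; μ] = ∫ σ, f σ * gt σ ∂μ - (∫ σ, f σ ∂μ) * ∫ σ, gt σ ∂μ := by
    have h1 : cov[f, g; μ] = cov[f, gt; μ] := by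
      rw [hgt, covariance_add_const_right hgi]
    rw [h1, covariance_eq_sub]
    · rfl
    · exact memLp_of_bounded (a := -Mf) (b := Mf)
        (ae_of_all _ fun σ => abs_le.1 (hMf σ)) hfm.aestronglyMeasurable 2
    · exact memLp_of_bounded (a := -(2 * Sg)) (b := 2 * Sg)
        (ae_of_all _ fun σ => abs_le.1 (hgtabs σ)) hgtm.aestronglyMeasurable 2
  by_cases hz : ∫ σ, gt σ ∂μ = 0
  · -- degenerate case: `g̃ = 0` a.e., so the covariance vanishes
    have hae : gt =ᵐ[μ] 0 := (integral_eq_zero_iff_of_nonneg (fun σ => hgt0 σ) hgti).1 hz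
    have hfg : ∫ σ, f σ * gt σ ∂μ = 0 := by
      rw [← integral_zero (α := V → S) (μ := μ) (G := ℝ)]
      refine integral_congr_ae ?_
      filter_upwards [hae] with σ hσ
      simp [hσ]
    rw [hcov, hfg, hz, mul_zero, sub_zero, abs_zero]
    exact hRHS
  have hpos : 0 < ∫ σ, gt σ ∂μ :=
    lt_of_le_of_ne (integral_nonneg hgt0) (Ne.symm hz)
  -- the comparison estimate between `μ` and its tilt by `g̃`
  let D := krDustingData hγ hC hr0 hrR hR ((↑Δg : Set V)ᶜ)
  have h₁ := isInvariantState_integral_of_isGibbsMeasure hγ hC hr0 hrR hR ((↑Δg : Set V)ᶜ) hμ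
  have h₂ := isInvariantState_tilt hγ hC hr0 hrR hR hμ hgtm hgtdep hgt0 hgtB hpos
  have hδf' := hδf.restrict hfdep
  have key := D.abs_sub_le_sum_pow_profile h₁ h₂ hc0 hc1
    (fun x _ => (sum_krDustingData_C hγ hC hr0 hrR hR _ x).le.trans (hrow x)) ℓ
    (fun y (hy : y ∉ ((↑Δg : Set V)ᶜ)) => hℓ0 y (by simpa using hy))
    (fun x (hx : x ∈ ((↑Δg : Set V)ᶜ)) y hy =>
      hℓ x (fun h' => (Set.mem_compl_iff _ _).1 hx (Finset.mem_coe.2 h')) y hy)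
    (f := f) (Δ := Δf) ⟨hfm, hfdep, Mf, hMf⟩ hδf' (fun y hy => if_neg hy)
  -- unfold the two states in `key`
  have hsum : ∑ y ∈ Δf, c ^ ℓ y * (if y ∈ Δf then δf y else 0) = ∑ y ∈ Δf, c ^ ℓ y * δf y :=
    Finset.sum_congr rfl fun y hy => by rw [if_pos hy]
  have key' : |∫ σ, f σ ∂μ - (∫ σ, gt σ * f σ ∂μ) / ∫ σ, gt σ ∂μ| ≤
      R * ∑ y ∈ Δf, c ^ ℓ y * δf y := by
    rw [← hsum]; exact key
  -- `cov = μ(g̃) · (μ_{g̃}(f) - μ(f))`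
  have hfgt : ∫ σ, f σ * gt σ ∂μ = ∫ σ, gt σ * f σ ∂μ :=
    integral_congr_ae (ae_of_all _ fun σ => mul_comm _ _)
  have hident : cov[f, g; μ] =
      (∫ σ, gt σ ∂μ) * ((∫ σ, gt σ * f σ ∂μ) / ∫ σ, gt σ ∂μ - ∫ σ, f σ ∂μ) := by
    rw [hcov, hfgt, mul_sub, mul_div_cancel₀ _ hz]
    ring
  rw [hident, abs_mul, abs_of_pos hpos, abs_sub_comm]
  have hgtint : ∫ σ, gt σ ∂μ ≤ 2 * Sg := by
    calc ∫ σ, gt σ ∂μ ≤ ∫ _σ, 2 * Sg ∂μ := integral_mono hgti (integrable_const _) hgtB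
      _ = 2 * Sg := by simp
  calc (∫ σ, gt σ ∂μ) * |∫ σ, f σ ∂μ - (∫ σ, gt σ * f σ ∂μ) / ∫ σ, gt σ ∂μ|
      ≤ (2 * Sg) * (R * ∑ y ∈ Δf, c ^ ℓ y * δf y) :=
        mul_le_mul hgtint key' (abs_nonneg _) (by positivity)
    _ = 2 * R ^ 2 * (∑ y ∈ Δg, δg y) * ∑ y ∈ Δf, c ^ ℓ y * δf y := by
        rw [hSg]; ring

end DobrushinMetric

end Literature.Probability.LatticeModels
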